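import Summits.Ventures.LatticeQCDFlow.Scaling.HubCollectorLaw
import Summits.Ventures.LatticeQCDFlow.Scaling.ReplicaExchangeStarFloor

/-!
HONEST FRAMING: exact (Metropolis-corrected) sampling algorithms for lattice gauge theory; figures
of merit are autocorrelation/cost numbers at stated couplings and volumes; no continuum-physics
claim.

# IdealStarAugmentation — THE IDEALISED HOT-ONLY HUB (ONE LAW `ν` AT EVERY LEVEL, IDENTITY MAPS, AN EXACT HOT SAMPLER)
# TAGGED WITH ITS STALE SET: EVERY SWAP IS ACCEPTED, THE AUGMENTED CHAIN `(configuration, stale set)` LUMPS ONTO THE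
# SCHEME AND ONTO THE AUTONOMOUS SET CHAIN OF `Scaling/DirtySetDecay`, AND ITS ONE-STEP ACTION ON LAWS IS EXPLICIT
# (lean-2 GEN-24, ours)

Venture-side (OURS).  Cell `lqcd-flow` (pub-lqcd), unit `pub-lqcd-lean-2-g24`, 2026-08-27.  Chapter L (the coupon-collector
law from a cold start), file 13 — the ceiling side, technical core.  THE IDEALISED STAR: hub list `e_r = (0, κ_r+1)`,
identity maps, the SAME positive probability vector `ν` at every level (perfect transports), hot-only updates
`w = 𝟙_{k=0}` with the EXACT hot sampler `M_0(u,v) = ν(v)`; scheme `P = t·GSw + (1−t)·PK` as in chapters G–K.  Since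
`π̃ = ν^{⊗(K+1)}` is exchangeable, every swap is accepted (`GSw` = the proposal).  The AUGMENTED CHAIN on
`(Fin (K+1) → S) × Finset (Fin (K+1))` carries the STALE SET `D` (positions whose configuration has not passed through a
hot refresh since time `0`): a swap `r` moves configurations and stale labels together
(`z ↦ z ∘ (0 κ_r+1)`, `D ↦ (0 κ_r+1)(D)`), a refresh redraws `z_0 ∼ ν` and deletes `0` from `D`.  Everything is carried as
hypothesis-equations (no definitions).

## What is proved

* §1 `sum_ptGraphProposal_eq_one`, `tensorFun_const_swap` (`π̃` is swap-invariant),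
  **`ptGraphSwap_eq_proposal_of_const`** (EVERY SWAP IS ACCEPTED), `prodKernel_hotOnly` (`PK = coordKernel M 0`),
  `sum_mul_coordKernel_zero` (`Σ_z f(z)·coordKernel M 0 (z,z') = Σ_u f(z'[0 ↦ u])·M_0(u, z'_0)`).
* §2 `ideal_aug_isRowStochastic`; the lumpings **`ideal_lump_fst`** (configuration marginal = the scheme) and
  **`ideal_lump_snd`** (stale-set marginal = the set chain `Q` of `Scaling/DirtySetDecay`); **`ideal_lawAt_fst`** /
  **`ideal_lawAt_snd`** (from `δ_{(x, univ)}`: `δ_x Pⁿ` and `δ_{univ} Qⁿ`).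
* §3 **`ideal_stepLaw_apply`** — THE ONE-STEP ACTION ON LAWS:
  `(λP̂)(z',D') = Σ_r (t/m)·λ(z'∘(0 κ_r+1), (0 κ_r+1)(D')) + (1−t)·ν(z'_0)·Σ_{D : D∖{0} = D'} Σ_u λ(z'[0 ↦ u], D)`.

Reading (no numerics implied): this is bookkeeping for the sequel (`Scaling/IdealStarFreshness`), which proves that
clean positions are exactly `ν`-distributed and independent (a minorisation `δ_x Pⁿ ≥ P(D_n = ∅)·π̃`) and hence the
`K·log K` mixing CEILING matching `Scaling/HubCollectorLaw`'s floor.  NOT CLAIMED here: anything quantitative.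
Literature grade (cell rule): OWN CONSTRUCTION; nothing cited as a fact; no new bib keys.
-/

noncomputable section

open Finset Function
open Literature.Probability.MarkovChains

namespace Summit.Ventures.LatticeQCDFlow.Scaling

variable {S : Type*} [Fintype S] [DecidableEq S] {K m : ℕ} {ν : S → ℝ} {M : Fin (K + 1) → S → S → ℝ} {t : ℝ}

/-! ## §1 Every swap is accepted; the hot-only update is a coordinate kernel -/

omit [DecidableEq S] in
/-- The graph proposal has row sums exactly `1` when the list is non-empty. [ours] -/
theorem sum_ptGraphProposal_eq_one [DecidableEq S] (hm : 1 ≤ m) (e : Fin m → Fin (K + 1) × Fin (K + 1))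
    (φ : Fin m → Equiv.Perm S) (x : Fin (K + 1) → S) : ∑ y, ptGraphProposal e φ x y = 1 := by
  have hmpos : (0 : ℝ) < m := Nat.cast_pos.mpr (by omega)
  unfold ptGraphProposal
  rw [Finset.sum_comm]
  simp_rw [Finset.sum_ite_eq' univ, if_pos (mem_univ _)]
  rw [sum_const, card_univ, Fintype.card_fin, nsmul_eq_mul, mul_one_div_cancel hmpos.ne']

omit [Fintype S] [DecidableEq S] in
/-- `π̃ = ν^{⊗(K+1)}` is invariant under exchanging two levels. [ours] -/
theorem tensorFun_const_swap (ν : S → ℝ) (i l : Fin (K + 1)) (x : Fin (K + 1) → S) :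
    tensorFun (fun _ : Fin (K + 1) => ν) (x ∘ Equiv.swap i l) = tensorFun (fun _ : Fin (K + 1) => ν) x := by
  unfold tensorFun
  exact Equiv.prod_comp (Equiv.swap i l) (fun k => ν (x k))

section Ideal
variable (κ : Fin m → Fin K)

/-- **EVERY SWAP IS ACCEPTED:** with one law at every level and identity maps, the Metropolis graph swap IS the
proposal: `GSw(y,z) = T(y,z)` (`ν > 0`, `m ≥ 1`). [ours] -/
theorem ptGraphSwap_eq_proposal_of_const (hm : 1 ≤ m) (hν : ∀ v, 0 < ν v) (y z : Fin (K + 1) → S) :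
    ptGraphSwap (fun _ : Fin (K + 1) => ν)
        (fun r : Fin m => (((0 : Fin (K + 1)), (κ r).succ) : Fin (K + 1) × Fin (K + 1))) (fun _ => Equiv.refl S) y z
      = ptGraphProposal (fun r : Fin m => (((0 : Fin (K + 1)), (κ r).succ) : Fin (K + 1) × Fin (K + 1)))
          (fun _ => Equiv.refl S) y z := by
  have he := hubList_fst_ne_snd (K := K) κ
  have hμ : ∀ (k : Fin (K + 1)) (v : S), 0 < (fun _ : Fin (K + 1) => ν) k v := fun _ v => hν v
  have hπ := tensorFun_pos hμ
  have hT : IsRowStochastic (ptGraphProposal (fun r : Fin m => (((0 : Fin (K + 1)), (κ r).succ) : Fin (K + 1) × Fin (K + 1)))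
      (fun _ => Equiv.refl S)) :=
    ⟨ptGraphProposal_nonneg _ _, sum_ptGraphProposal_eq_one hm _ _⟩
  refine eq_of_offDiag_eq (ptGraphSwap_isRowStochastic hμ) hT (fun y z hzy => ?_) y z
  have h := tensorFun_mul_ptGraphSwap (e := fun r : Fin m => (((0 : Fin (K + 1)), (κ r).succ) : Fin (K + 1) × Fin (K + 1)))
    (φ := fun _ => Equiv.refl S) hμ he hzy
  -- either `z` is a swap of `y` (then `π̃ z = π̃ y`) or the proposal vanishes
  by_cases hTz : ptGraphProposal (fun r : Fin m => (((0 : Fin (K + 1)), (κ r).succ) : Fin (K + 1) × Fin (K + 1)))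
      (fun _ => Equiv.refl S) y z = 0
  · rw [hTz]
    have h0 := mhKernel_le_of_ne (ptGraphProposal (fun r : Fin m => (((0 : Fin (K + 1)), (κ r).succ) :
      Fin (K + 1) × Fin (K + 1))) (fun _ => Equiv.refl S)) (tensorFun (fun _ : Fin (K + 1) => ν)) (Ne.symm hzy)
    rw [hTz] at h0
    exact le_antisymm h0 ((ptGraphSwap_isRowStochastic hμ).1 y z)
  · -- some entry `r` has `z = y ∘ (0 κ_r+1)`
    have hex : ∃ r : Fin m, z = edgeFlowSwap (Equiv.refl S) 0 (κ r).succ y := by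
      by_contra hne
      apply hTz
      unfold ptGraphProposal
      exact sum_eq_zero fun r _ => if_neg fun h' => hne ⟨r, h'⟩
    obtain ⟨r, hr⟩ := hex
    have hπeq : tensorFun (fun _ : Fin (K + 1) => ν) z = tensorFun (fun _ : Fin (K + 1) => ν) y := by
      rw [hr, edgeFlowSwap_one (he r), tensorFun_const_swap]
    rw [hπeq, min_self, mul_comm] at h
    exact mul_right_cancel₀ (hπ y).ne' h

omit [Fintype S] in
/-- **The hot-only update is the coordinate kernel at the hot level:** `PK(y,z) = coordKernel M 0 (y,z)`. [ours] -/
theorem prodKernel_hotOnly (y z : Fin (K + 1) → S) :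
    prodKernel (fun k : Fin (K + 1) => if k = 0 then (1 : ℝ) else 0) M y z = coordKernel M 0 y z := by
  rw [prodKernel_apply]
  simp_rw [ite_mul, one_mul, zero_mul]
  rw [Finset.sum_ite_eq' univ (0 : Fin (K + 1)), if_pos (mem_univ _)]

/-- **Integrating a function against the hot coordinate kernel:**
`Σ_z f(z)·coordKernel M 0 (z,z') = Σ_u f(z'[0 ↦ u])·M_0(u, z'_0)`. [ours] -/
theorem sum_mul_coordKernel_zero (f : (Fin (K + 1) → S) → ℝ) (z' : Fin (K + 1) → S) :
    ∑ z, f z * coordKernel M 0 z z' = ∑ u : S, f (update z' 0 u) * M 0 u (z' 0) := by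
  -- `coordKernel M 0 z z' = Σ_u 𝟙{z = z'[0 ↦ u]}·M_0(u, z'_0)`
  have hck : ∀ z : Fin (K + 1) → S, coordKernel M 0 z z' = ∑ u : S, (if z = update z' 0 u then M 0 u (z' 0) else 0) := by
    intro z
    unfold coordKernel
    by_cases hz : z' = update z 0 (z' 0)
    · rw [if_pos hz]
      have hzu : z = update z' 0 (z 0) := by
        conv_lhs => rw [← update_eq_self 0 z]
        rw [hz, update_idem]
      rw [Finset.sum_eq_single (z 0)]
      · rw [if_pos hzu]
      · intro u _ hu
        rw [if_neg]
        intro h; apply hu; have := congrFun h 0; rw [update_self] at this; exact this.symm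
      · intro h; exact absurd (mem_univ _) h
    · rw [if_neg hz]
      refine (sum_eq_zero fun u _ => if_neg fun h => hz ?_).symm
      rw [h, update_idem, update_eq_self]
  simp_rw [hck, mul_sum]
  rw [Finset.sum_comm]
  refine sum_congr rfl fun u _ => ?_
  simp_rw [mul_ite, mul_zero]
  rw [Finset.sum_ite_eq' univ (update z' 0 u), if_pos (mem_univ _)]

/-- The hot coordinate kernel with the exact sampler has unit column-sums against any `f ≡ 1` row:
`Σ_{z'} coordKernel M 0 (z,z') = 1` (`M_0` row-stochastic). [ours] -/
theorem sum_coordKernel_zero_eq_one (hM : ∀ k, IsRowStochastic (M k)) (z : Fin (K + 1) → S) :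
    ∑ z', coordKernel M 0 z z' = 1 := by
  have h := sum_coordKernel_mul M 0 z (fun _ => (1 : ℝ))
  simp only [mul_one] at h
  rw [h, (hM 0).2]

/-! ## §2 The augmented chain and its two lumpings -/

/-- The augmented chain is a transition matrix (`0 ≤ t ≤ 1`, `m ≥ 1`, `M_0` row-stochastic). [ours] -/
theorem ideal_aug_isRowStochastic (hm : 1 ≤ m) (ht0 : 0 ≤ t) (ht1 : t ≤ 1) (hM : ∀ k, IsRowStochastic (M k))
    {Ph : (Fin (K + 1) → S) × Finset (Fin (K + 1)) → (Fin (K + 1) → S) × Finset (Fin (K + 1)) → ℝ}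
    (hPh : ∀ p q, Ph p q = ∑ r : Fin m, t / m *
        (if q.1 = edgeFlowSwap (Equiv.refl S) 0 (κ r).succ p.1 ∧ q.2 = p.2.image (Equiv.swap (0 : Fin (K + 1)) (κ r).succ)
          then (1 : ℝ) else 0)
      + (1 - t) * (coordKernel M 0 p.1 q.1 * (if q.2 = p.2.erase 0 then (1 : ℝ) else 0))) :
    IsRowStochastic Ph := by
  have hmpos : (0 : ℝ) < m := Nat.cast_pos.mpr (by omega)
  refine ⟨fun p q => ?_, fun p => ?_⟩
  · rw [hPh]
    exact add_nonneg (sum_nonneg fun r _ => mul_nonneg (by positivity) (by split_ifs <;> norm_num))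
      (mul_nonneg (by linarith) (mul_nonneg (coordKernel_nonneg M (fun j u v => (hM j).1 u v) 0 _ _)
        (by split_ifs <;> norm_num)))
  · have h1 : ∀ r : Fin m, ∑ q : (Fin (K + 1) → S) × Finset (Fin (K + 1)),
        (if q.1 = edgeFlowSwap (Equiv.refl S) 0 (κ r).succ p.1 ∧ q.2 = p.2.image (Equiv.swap (0 : Fin (K + 1)) (κ r).succ)
          then (1 : ℝ) else 0) = 1 := by
      intro r
      rw [Finset.sum_eq_single (edgeFlowSwap (Equiv.refl S) 0 (κ r).succ p.1,
        p.2.image (Equiv.swap (0 : Fin (K + 1)) (κ r).succ))]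
      · rw [if_pos ⟨rfl, rfl⟩]
      · intro q _ hq
        rw [if_neg]
        rintro ⟨h1, h2⟩
        exact hq (Prod.ext h1 h2)
      · intro h; exact absurd (mem_univ _) h
    have h2 : ∑ q : (Fin (K + 1) → S) × Finset (Fin (K + 1)),
        coordKernel M 0 p.1 q.1 * (if q.2 = p.2.erase 0 then (1 : ℝ) else 0) = 1 := by
      rw [Fintype.sum_prod_type]
      have : ∀ z : Fin (K + 1) → S, ∑ D : Finset (Fin (K + 1)),
          coordKernel M 0 p.1 (z, D).1 * (if (z, D).2 = p.2.erase 0 then (1 : ℝ) else 0) = coordKernel M 0 p.1 z := by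
        intro z
        dsimp only
        rw [← Finset.mul_sum, Finset.sum_ite_eq' univ (p.2.erase 0), if_pos (mem_univ _), mul_one]
      simp_rw [this]
      exact sum_coordKernel_zero_eq_one hM p.1
    have hsplit : ∑ q, Ph p q = (∑ r : Fin m, t / m * ∑ q : (Fin (K + 1) → S) × Finset (Fin (K + 1)),
        (if q.1 = edgeFlowSwap (Equiv.refl S) 0 (κ r).succ p.1 ∧ q.2 = p.2.image (Equiv.swap (0 : Fin (K + 1)) (κ r).succ)
          then (1 : ℝ) else 0))
        + (1 - t) * ∑ q : (Fin (K + 1) → S) × Finset (Fin (K + 1)),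
          coordKernel M 0 p.1 q.1 * (if q.2 = p.2.erase 0 then (1 : ℝ) else 0) := by
      have hswap : ∑ r : Fin m, t / m * ∑ q : (Fin (K + 1) → S) × Finset (Fin (K + 1)),
          (if q.1 = edgeFlowSwap (Equiv.refl S) 0 (κ r).succ p.1 ∧ q.2 = p.2.image (Equiv.swap (0 : Fin (K + 1)) (κ r).succ)
            then (1 : ℝ) else 0)
          = ∑ q : (Fin (K + 1) → S) × Finset (Fin (K + 1)), ∑ r : Fin m, t / m *
            (if q.1 = edgeFlowSwap (Equiv.refl S) 0 (κ r).succ p.1 ∧ q.2 = p.2.image (Equiv.swap (0 : Fin (K + 1)) (κ r).succ)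
              then (1 : ℝ) else 0) := by
        rw [Finset.sum_comm]; simp_rw [Finset.mul_sum]
      rw [hswap, Finset.mul_sum, ← Finset.sum_add_distrib]
      exact sum_congr rfl fun q _ => by rw [hPh]
    rw [hsplit]
    simp_rw [h1, h2, mul_one, sum_const, card_univ, Fintype.card_fin, nsmul_eq_mul]
    have e : (m : ℝ) * (t / m) + (1 - t) = 1 := by field_simp; ring
    exact e

/-- **FIRST LUMPING: the configuration marginal of the augmented chain is the idealised scheme.** [ours] -/
theorem ideal_lump_fst (hm : 1 ≤ m) (hν : ∀ v, 0 < ν v)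
    {Ph : (Fin (K + 1) → S) × Finset (Fin (K + 1)) → (Fin (K + 1) → S) × Finset (Fin (K + 1)) → ℝ}
    (hPh : ∀ p q, Ph p q = ∑ r : Fin m, t / m *
        (if q.1 = edgeFlowSwap (Equiv.refl S) 0 (κ r).succ p.1 ∧ q.2 = p.2.image (Equiv.swap (0 : Fin (K + 1)) (κ r).succ)
          then (1 : ℝ) else 0)
      + (1 - t) * (coordKernel M 0 p.1 q.1 * (if q.2 = p.2.erase 0 then (1 : ℝ) else 0)))
    (p : (Fin (K + 1) → S) × Finset (Fin (K + 1))) (z' : Fin (K + 1) → S) :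
    t * ptGraphSwap (fun _ : Fin (K + 1) => ν)
          (fun r : Fin m => (((0 : Fin (K + 1)), (κ r).succ) : Fin (K + 1) × Fin (K + 1))) (fun _ => Equiv.refl S) p.1 z'
        + (1 - t) * prodKernel (fun k : Fin (K + 1) => if k = 0 then (1 : ℝ) else 0) M p.1 z'
      = ∑ q ∈ univ.filter (fun q : (Fin (K + 1) → S) × Finset (Fin (K + 1)) => q.1 = z'), Ph p q := by
  rw [sum_filter_prodFst_eq, ptGraphSwap_eq_proposal_of_const κ hm hν, prodKernel_hotOnly]
  simp_rw [hPh, Finset.sum_add_distrib]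
  congr 1
  · unfold ptGraphProposal
    rw [Finset.mul_sum, Finset.sum_comm]
    refine sum_congr rfl fun r _ => ?_
    rw [← Finset.mul_sum]
    by_cases hz : z' = edgeFlowSwap (Equiv.refl S) 0 (κ r).succ p.1
    · rw [if_pos hz]
      have : ∑ D' : Finset (Fin (K + 1)), (if z' = edgeFlowSwap (Equiv.refl S) 0 (κ r).succ p.1 ∧
          D' = p.2.image (Equiv.swap (0 : Fin (K + 1)) (κ r).succ) then (1 : ℝ) else 0) = 1 := by
        simp_rw [hz, true_and]
        rw [Finset.sum_ite_eq' univ, if_pos (mem_univ _)]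
      rw [this]; ring
    · rw [if_neg hz]
      have : ∑ D' : Finset (Fin (K + 1)), (if z' = edgeFlowSwap (Equiv.refl S) 0 (κ r).succ p.1 ∧
          D' = p.2.image (Equiv.swap (0 : Fin (K + 1)) (κ r).succ) then (1 : ℝ) else 0) = 0 :=
        sum_eq_zero fun D' _ => if_neg (show ¬(z' = edgeFlowSwap (Equiv.refl S) 0 (κ r).succ p.1 ∧
          D' = p.2.image (Equiv.swap (0 : Fin (K + 1)) (κ r).succ)) from fun h => hz h.1)
      rw [this]; ring
  · rw [← Finset.mul_sum]
    congr 1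
    rw [← Finset.mul_sum, Finset.sum_ite_eq' univ (p.2.erase 0), if_pos (mem_univ _), mul_one]

/-- **SECOND LUMPING: the stale-set marginal of the augmented chain is the set chain `Q`.** [ours] -/
theorem ideal_lump_snd (hM : ∀ k, IsRowStochastic (M k))
    {Ph : (Fin (K + 1) → S) × Finset (Fin (K + 1)) → (Fin (K + 1) → S) × Finset (Fin (K + 1)) → ℝ}
    (hPh : ∀ p q, Ph p q = ∑ r : Fin m, t / m *
        (if q.1 = edgeFlowSwap (Equiv.refl S) 0 (κ r).succ p.1 ∧ q.2 = p.2.image (Equiv.swap (0 : Fin (K + 1)) (κ r).succ)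
          then (1 : ℝ) else 0)
      + (1 - t) * (coordKernel M 0 p.1 q.1 * (if q.2 = p.2.erase 0 then (1 : ℝ) else 0)))
    {Q : Finset (Fin (K + 1)) → Finset (Fin (K + 1)) → ℝ}
    (hQ : ∀ D D', Q D D' = ∑ r : Fin m, t / m * (if D' = D.image (Equiv.swap (0 : Fin (K + 1)) (κ r).succ) then (1 : ℝ)
      else 0) + (1 - t) * (if D' = D.erase 0 then (1 : ℝ) else 0))
    (p : (Fin (K + 1) → S) × Finset (Fin (K + 1))) (D' : Finset (Fin (K + 1))) :
    Q p.2 D' = ∑ q ∈ univ.filter (fun q : (Fin (K + 1) → S) × Finset (Fin (K + 1)) => q.2 = D'), Ph p q := by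
  rw [sum_filter_prodSnd_eq, hQ]
  simp_rw [hPh, Finset.sum_add_distrib]
  congr 1
  · rw [Finset.sum_comm]
    refine sum_congr rfl fun r _ => ?_
    rw [← Finset.mul_sum]
    congr 1
    by_cases hD : D' = p.2.image (Equiv.swap (0 : Fin (K + 1)) (κ r).succ)
    · rw [if_pos hD]
      simp_rw [hD, and_true]
      rw [Finset.sum_ite_eq' univ, if_pos (mem_univ _)]
    · rw [if_neg hD]
      exact (sum_eq_zero fun z _ => if_neg (show ¬(z = edgeFlowSwap (Equiv.refl S) 0 (κ r).succ p.1 ∧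
        D' = p.2.image (Equiv.swap (0 : Fin (K + 1)) (κ r).succ)) from fun h => hD h.2)).symm
  · rw [← Finset.mul_sum]
    congr 1
    calc (if D' = p.2.erase 0 then (1 : ℝ) else 0)
        = (∑ z : Fin (K + 1) → S, coordKernel M 0 p.1 z) * (if D' = p.2.erase 0 then (1 : ℝ) else 0) := by
          rw [sum_coordKernel_zero_eq_one hM, one_mul]
      _ = ∑ z : Fin (K + 1) → S, coordKernel M 0 p.1 z * (if D' = p.2.erase 0 then (1 : ℝ) else 0) := Finset.sum_mul _ _ _

/-- **From `δ_{(x, univ)}`: the configuration marginal of the augmented chain at time `n` is `δ_x Pⁿ`.** [ours] -/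
theorem ideal_lawAt_fst (hm : 1 ≤ m) (hν : ∀ v, 0 < ν v)
    {Ph : (Fin (K + 1) → S) × Finset (Fin (K + 1)) → (Fin (K + 1) → S) × Finset (Fin (K + 1)) → ℝ}
    (hPh : ∀ p q, Ph p q = ∑ r : Fin m, t / m *
        (if q.1 = edgeFlowSwap (Equiv.refl S) 0 (κ r).succ p.1 ∧ q.2 = p.2.image (Equiv.swap (0 : Fin (K + 1)) (κ r).succ)
          then (1 : ℝ) else 0)
      + (1 - t) * (coordKernel M 0 p.1 q.1 * (if q.2 = p.2.erase 0 then (1 : ℝ) else 0)))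
    (x : Fin (K + 1) → S) (n : ℕ) (z : Fin (K + 1) → S) :
    ∑ D : Finset (Fin (K + 1)), lawAt Ph (Pi.single (x, (univ : Finset (Fin (K + 1)))) 1) n (z, D)
      = lawAt (fun y z : Fin (K + 1) → S => t * ptGraphSwap (fun _ : Fin (K + 1) => ν)
          (fun r : Fin m => (((0 : Fin (K + 1)), (κ r).succ) : Fin (K + 1) × Fin (K + 1))) (fun _ => Equiv.refl S) y z
          + (1 - t) * prodKernel (fun k : Fin (K + 1) => if k = 0 then (1 : ℝ) else 0) M y z) (Pi.single x 1) n z := by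
  rw [← sum_filter_prodFst_eq (fun q => lawAt Ph (Pi.single (x, (univ : Finset (Fin (K + 1)))) 1) n q) z,
    LevinPeres2017_lemma_2_5_lawAt (P := Ph) (proj := Prod.fst)
      (Ps := fun y z : Fin (K + 1) → S => t * ptGraphSwap (fun _ : Fin (K + 1) => ν)
          (fun r : Fin m => (((0 : Fin (K + 1)), (κ r).succ) : Fin (K + 1) × Fin (K + 1))) (fun _ => Equiv.refl S) y z
          + (1 - t) * prodKernel (fun k : Fin (K + 1) => if k = 0 then (1 : ℝ) else 0) M y z)
      (fun p z' => ideal_lump_fst κ hm hν hPh p z')]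
  congr 1
  funext z'
  exact sum_filter_prodFst_single x univ z'

/-- **From `δ_{(x, univ)}`: the stale-set marginal at time `n` is `δ_{univ} Qⁿ` — the same for every start `x`.**
[ours] -/
theorem ideal_lawAt_snd (hM : ∀ k, IsRowStochastic (M k))
    {Ph : (Fin (K + 1) → S) × Finset (Fin (K + 1)) → (Fin (K + 1) → S) × Finset (Fin (K + 1)) → ℝ}
    (hPh : ∀ p q, Ph p q = ∑ r : Fin m, t / m *
        (if q.1 = edgeFlowSwap (Equiv.refl S) 0 (κ r).succ p.1 ∧ q.2 = p.2.image (Equiv.swap (0 : Fin (K + 1)) (κ r).succ)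
          then (1 : ℝ) else 0)
      + (1 - t) * (coordKernel M 0 p.1 q.1 * (if q.2 = p.2.erase 0 then (1 : ℝ) else 0)))
    {Q : Finset (Fin (K + 1)) → Finset (Fin (K + 1)) → ℝ}
    (hQ : ∀ D D', Q D D' = ∑ r : Fin m, t / m * (if D' = D.image (Equiv.swap (0 : Fin (K + 1)) (κ r).succ) then (1 : ℝ)
      else 0) + (1 - t) * (if D' = D.erase 0 then (1 : ℝ) else 0))
    (x : Fin (K + 1) → S) (n : ℕ) (D : Finset (Fin (K + 1))) :
    ∑ z : Fin (K + 1) → S, lawAt Ph (Pi.single (x, (univ : Finset (Fin (K + 1)))) 1) n (z, D)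
      = lawAt Q (Pi.single (univ : Finset (Fin (K + 1))) 1) n D := by
  rw [← sum_filter_prodSnd_eq (fun q => lawAt Ph (Pi.single (x, (univ : Finset (Fin (K + 1)))) 1) n q) D,
    LevinPeres2017_lemma_2_5_lawAt (P := Ph) (proj := Prod.snd) (Ps := Q) (fun p D' => ideal_lump_snd κ hM hPh hQ p D')]
  congr 1
  funext D'
  exact sum_filter_prodSnd_single x univ D'

/-! ## §3 The one-step action on laws -/

/-- **THE ONE-STEP ACTION OF THE AUGMENTED CHAIN ON A LAW `λ`:**
`(λP̂)(z',D') = Σ_r (t/m)·λ(z' ∘ (0 κ_r+1), (0 κ_r+1)(D')) + (1−t)·M_0(·)… ` — precisely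
`= Σ_r (t/m)·λ(sw_r z', σ_r(D')) + (1−t)·Σ_{D : D ∖ {0} = D'} Σ_u λ(z'[0 ↦ u], D)·M_0(u, z'_0)`. [ours] -/
theorem ideal_stepLaw_apply
    {Ph : (Fin (K + 1) → S) × Finset (Fin (K + 1)) → (Fin (K + 1) → S) × Finset (Fin (K + 1)) → ℝ}
    (hPh : ∀ p q, Ph p q = ∑ r : Fin m, t / m *
        (if q.1 = edgeFlowSwap (Equiv.refl S) 0 (κ r).succ p.1 ∧ q.2 = p.2.image (Equiv.swap (0 : Fin (K + 1)) (κ r).succ)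
          then (1 : ℝ) else 0)
      + (1 - t) * (coordKernel M 0 p.1 q.1 * (if q.2 = p.2.erase 0 then (1 : ℝ) else 0)))
    (lam : (Fin (K + 1) → S) × Finset (Fin (K + 1)) → ℝ) (z' : Fin (K + 1) → S) (D' : Finset (Fin (K + 1))) :
    stepLaw Ph lam (z', D')
      = ∑ r : Fin m, t / m * lam (edgeFlowSwap (Equiv.refl S) 0 (κ r).succ z',
          D'.image (Equiv.swap (0 : Fin (K + 1)) (κ r).succ))
        + (1 - t) * ∑ D ∈ univ.filter (fun D : Finset (Fin (K + 1)) => D.erase 0 = D'),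
            ∑ u : S, lam (update z' 0 u, D) * M 0 u (z' 0) := by
  have he := hubList_fst_ne_snd (K := K) κ
  unfold stepLaw
  simp_rw [hPh, mul_add, Finset.sum_add_distrib]
  congr 1
  · -- swap part: the unique predecessor of `(z', D')` under entry `r`
    simp_rw [Finset.mul_sum]
    rw [Finset.sum_comm]
    refine sum_congr rfl fun r _ => ?_
    have hinvz : ∀ z : Fin (K + 1) → S, z' = edgeFlowSwap (Equiv.refl S) 0 (κ r).succ z ↔
        z = edgeFlowSwap (Equiv.refl S) 0 (κ r).succ z' := fun z => eq_edgeFlowSwap_comm _ (he r) z z'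
    have hinvD : ∀ D : Finset (Fin (K + 1)), D' = D.image (Equiv.swap (0 : Fin (K + 1)) (κ r).succ) ↔
        D = D'.image (Equiv.swap (0 : Fin (K + 1)) (κ r).succ) := by
      intro D
      have hinv : ∀ E : Finset (Fin (K + 1)), (E.image (Equiv.swap (0 : Fin (K + 1)) (κ r).succ)).image
          (Equiv.swap (0 : Fin (K + 1)) (κ r).succ) = E := fun E => by
        rw [Finset.image_image]
        convert Finset.image_id (s := E) using 2
        funext k; simp [Equiv.swap_apply_self]
      constructor
      · intro h; rw [h, hinv]
      · intro h; rw [h, hinv]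
    rw [Fintype.sum_prod_type]
    simp_rw [hinvz, hinvD]
    rw [Finset.sum_eq_single (edgeFlowSwap (Equiv.refl S) 0 (κ r).succ z')]
    · rw [Finset.sum_eq_single (D'.image (Equiv.swap (0 : Fin (K + 1)) (κ r).succ))]
      · rw [if_pos ⟨rfl, rfl⟩]; ring
      · intro D _ hD
        rw [if_neg (show ¬(edgeFlowSwap (Equiv.refl S) 0 (κ r).succ z' = edgeFlowSwap (Equiv.refl S) 0 (κ r).succ z' ∧
          D = D'.image (Equiv.swap (0 : Fin (K + 1)) (κ r).succ)) from fun h => hD h.2)]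
        ring
      · intro h; exact absurd (mem_univ _) h
    · intro z _ hz
      exact sum_eq_zero fun D _ => by
        rw [if_neg (show ¬(z = edgeFlowSwap (Equiv.refl S) 0 (κ r).succ z' ∧
          D = D'.image (Equiv.swap (0 : Fin (K + 1)) (κ r).succ)) from fun h => hz h.1)]
        ring
    · intro h; exact absurd (mem_univ _) h
  · -- refresh part
    simp_rw [Finset.mul_sum]
    rw [Fintype.sum_prod_type, Finset.sum_comm]
    -- `Σ_D Σ_z λ(z,D)·(1−t)·cK(z,z')·𝟙{D' = D∖0}`
    rw [Finset.sum_filter]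
    refine sum_congr rfl fun D _ => ?_
    by_cases hD : D' = D.erase 0
    · simp_rw [if_pos hD, mul_one, if_pos hD.symm]
      have h := sum_mul_coordKernel_zero (M := M) (fun z => lam (z, D)) z'
      calc ∑ z, lam (z, D) * ((1 - t) * coordKernel M 0 z z')
          = (1 - t) * ∑ z, lam (z, D) * coordKernel M 0 z z' := by
            rw [Finset.mul_sum]; exact sum_congr rfl fun z _ => by ring
        _ = (1 - t) * ∑ u : S, lam (update z' 0 u, D) * M 0 u (z' 0) := by rw [h]
        _ = ∑ u : S, (1 - t) * (lam (update z' 0 u, D) * M 0 u (z' 0)) := by rw [Finset.mul_sum]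
    · simp_rw [if_neg hD, mul_zero, if_neg (fun h : D.erase 0 = D' => hD h.symm)]
      simp

end Ideal

end Summit.Ventures.LatticeQCDFlow.Scaling

end
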